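import Mathlib
import Summits.Ventures.HodgeRepro2.A2TripleSumPairing
import Summits.Ventures.HodgeRepro2.A2IntegralDegree

/-!
# A2 annex — Corollary A8.2, second half: the symmetric form and the degree-graded form

`A2TripleSumPairing` proved Corollary A8.2 of route/T4-A2-p6.md v6 (ll. 115–118) in the twelve-plane
model with the hypothesis of Proposition A8.1 imposed on the SECOND curve class `c₂` only (the right
tensor factor of `Δ w_σ`).  This file adds

* `mono_mem_grading`: a monomial of length `n` lies in `⋀^n`;
* `inr_gen_mul_mono_tmul`: the Koszul sign of `(1 ⊗ e) · (e₁ ∧ ⋯ ∧ e_n ⊗ y) = (−1)^n (e₁ ∧ ⋯ ∧ e_n) ⊗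
  (e ∧ y)` (Mathlib's `GradedTensorProduct.tmul_coe_mul_coe_tmul`);
* `cop_mono_mem_span_left`: the expansion of `Δ(e₁ ∧ ⋯ ∧ e_n)` with the LEFT factor controlled;
* `pairTwo_cop_mono_eq_zero_left` and **`pairThree_theta_pow_mul_weil_eq_zero_left`** /
  **`pairThree_integral_eq_zero_left`**: Corollary A8.2 with the hypotheses on `c₁` alone — so the
  printed proof's symmetric use of Prop. A8.1 («each first factor vanishes by Prop. A8.1») is covered in
  both readings, and either curve class alone suffices;
* **`pairThree_integral_eq_zero_of_mem_grading`** / **`..._left`**: the degree hypothesis in its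
  geometric form `z_j ∈ ⋀^{2|ι| − 2}` (`deg f_*c_j = 22` for `|ι| = 12`) via `A2IntegralDegree`;
* **`integral_mul_ET_mul_weil_eq_zero_of_represents`**: the conclusion in the coordinates of
  Lemma A5.6 — for any `y` representing `y'` against `∫_B`, the Weil coordinate
  `∫_B y ∧ E_{I_σ} ∧ w_σ` vanishes (`c_p ≠ 0` as in A4.2.7), i.e. `p_W(y') = 0` in p5's
  coordinate form of A5.6.

What stays prose is as in `A2TripleSumPairing`.  Seat p6 (A2 owner), gen 16.
§8 (d): uses an L-value-free non-vanishing device: NO.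
-/

namespace Summit.Ventures.HodgeRepro2.A2TripleSumPairingDegree

open WeilPlanes WeilIntegral WeilDetect WeilCoproduct WeilPairing A2TripleSumPairing A2IntegralDegree
open scoped TensorProduct

variable {ι : Type*} [DecidableEq ι]

/-- A monomial of length `n` lies in `⋀^n V ι = grading ι n`. -/
theorem mono_mem_grading (l : List (Gen ι)) : mono l ∈ grading ι l.length := by
  induction l with
  | nil =>
    simp only [mono, List.map_nil, List.prod_nil, List.length_nil, grading,
      ExteriorAlgebra.exteriorPower, pow_zero]
    exact Submodule.one_le.mp le_rfl
  | cons g l ih =>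
    rw [WeilIntegral.mono_cons, List.length_cons, grading, ExteriorAlgebra.exteriorPower, pow_succ']
    exact Submodule.mul_mem_mul (LinearMap.mem_range_self _ _) ih

/-- `((-1 : ℤˣ) ^ n) • Z = ((-1 : ℂ) ^ n) • Z` on a complex vector space (the `ℤˣ`-power is
Mathlib's `uzpow`, the scalar of `GradedTensorProduct.tmul_coe_mul_coe_tmul`). -/
theorem neg_one_uzpow_smul {M : Type*} [AddCommGroup M] [Module ℂ M] (n : ℕ) (Z : M) :
    ((-1 : ℤˣ) ^ n) • Z = ((-1 : ℂ) ^ n) • Z := by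
  induction n with
  | zero => rw [uzpow_zero, pow_zero, one_smul, one_smul]
  | succ n ih =>
    have h1 : (-1 : ℤˣ) • Z = -Z := by
      rw [Units.smul_def, Units.val_neg, Units.val_one, neg_one_zsmul]
    rw [uzpow_add, uzpow_one, mul_smul, h1, smul_neg, ih, pow_succ, mul_smul, neg_one_smul, smul_neg]

/-- The Koszul sign: `(1 ⊗ e_g) · (mono l ⊗ y) = (−1)^{|l|} • (mono l ⊗ (e_g ∧ y))` in `AA ι`. -/
theorem inr_gen_mul_mono_tmul (g : Gen ι) (l : List (Gen ι)) (y : A ι) :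
    inr (gen g) * (mono l ᵍ⊗ₜ[ℂ] y) = ((-1 : ℂ) ^ l.length) • (mono l ᵍ⊗ₜ[ℂ] (gen g * y)) := by
  have h := GradedTensorProduct.tmul_coe_mul_coe_tmul (grading ι) (grading ι) (1 : A ι)
    (⟨gen g, ι_mem_one _⟩ : grading ι 1) (⟨mono l, mono_mem_grading l⟩ : grading ι l.length) y
  simp only [one_mul] at h
  rw [show inr (gen g) = (1 : A ι) ᵍ⊗ₜ[ℂ] gen g from GradedTensorProduct.includeRight_apply _ _ _, h,
    neg_one_uzpow_smul]

/-- The set of pure tensors whose left factor is a sub-monomial of `mono l`. -/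
def leftSubmono (l : List (Gen ι)) : Set (AA ι) :=
  {Z | ∃ l₁ : List (Gen ι), ∃ y : A ι, l₁.Sublist l ∧ Z = mono l₁ ᵍ⊗ₜ[ℂ] y}

/-- The expansion of `Δ(e₁ ∧ ⋯ ∧ e_n)` with the left factor controlled: every term is
`± (sub-monomial) ⊗ (complementary sub-monomial)`. -/
theorem cop_mono_mem_span_left (l : List (Gen ι)) :
    cop (mono l) ∈ Submodule.span ℂ (leftSubmono l) := by
  induction l with
  | nil =>
    refine Submodule.subset_span ⟨[], 1, List.Sublist.refl _, ?_⟩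
    simp [mono, one_eq_tmul_one]
  | cons g l ih =>
    rw [WeilIntegral.mono_cons, map_mul, cop_gen, add_mul]
    refine Submodule.add_mem _ ?_ ?_
    · refine Submodule.span_induction
        (p := fun Z _ => inl (gen g) * Z ∈ Submodule.span ℂ (leftSubmono (g :: l))) ?_ ?_ ?_ ?_ ih
      · rintro Z ⟨l₁, y, hl₁, rfl⟩
        rw [inl_mul_tmul, ← WeilIntegral.mono_cons]
        exact Submodule.subset_span ⟨g :: l₁, y, hl₁.cons_cons g, rfl⟩
      · simp
      · intro Z Z' _ _ hZ hZ'
        rw [mul_add]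
        exact Submodule.add_mem _ hZ hZ'
      · intro a Z _ hZ
        rw [mul_smul_comm]
        exact Submodule.smul_mem _ a hZ
    · refine Submodule.span_induction
        (p := fun Z _ => inr (gen g) * Z ∈ Submodule.span ℂ (leftSubmono (g :: l))) ?_ ?_ ?_ ?_ ih
      · rintro Z ⟨l₁, y, hl₁, rfl⟩
        rw [inr_gen_mul_mono_tmul]
        exact Submodule.smul_mem _ _ (Submodule.subset_span ⟨l₁, gen g * y, hl₁.cons g, rfl⟩)
      · simp
      · intro Z Z' _ _ hZ hZ'
        rw [mul_add]
        exact Submodule.add_mem _ hZ hZ'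
      · intro a Z _ hZ
        rw [mul_smul_comm]
        exact Submodule.smul_mem _ a hZ

/-- `(Φ₁ ⊗ Φ₂)(Δ(e₁ ∧ ⋯ ∧ e_n)) = 0` when `Φ₁` kills the monomials of length `≠ 2` and the pairs
`e_{a,σ} ∧ e_{b,σ}`, `a ≠ b` in `P₀` (the mirror image of `A2TripleSumPairing.pairTwo_cop_mono_eq_zero`). -/
theorem pairTwo_cop_mono_eq_zero_left (P₀ : Finset ι) (s : Bool) (Φ₁ Φ₂ : A ι →ₗ[ℂ] ℂ)
    (hdeg : ∀ l : List (Gen ι), l.length ≠ 2 → Φ₁ (mono l) = 0)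
    (hA81 : ∀ a ∈ P₀, ∀ b ∈ P₀, a ≠ b → Φ₁ (gen (a, s) * gen (b, s)) = 0)
    (l : List (Gen ι)) (hl : l.Nodup) (hlP : ∀ j ∈ l, j.1 ∈ P₀ ∧ j.2 = s) :
    pairTwo Φ₁ Φ₂ (cop (mono l)) = 0 := by
  have key : ∀ l₁ : List (Gen ι), l₁.Sublist l → Φ₁ (mono l₁) = 0 := by
    intro l₁ hl₁
    by_cases h2 : l₁.length = 2
    · obtain ⟨j, k, rfl⟩ := List.length_eq_two.mp h2
      have hnd : [j, k].Nodup := hl₁.nodup hl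
      have hjk : j ≠ k := by
        simpa [List.nodup_cons] using hnd
      have hj := hlP j (hl₁.subset (by simp))
      have hk := hlP k (hl₁.subset (by simp))
      have hjk1 : j.1 ≠ k.1 := by
        intro h
        exact hjk (Prod.ext h (hj.2.trans hk.2.symm))
      have hj' : j = (j.1, s) := Prod.ext rfl hj.2
      have hk' : k = (k.1, s) := Prod.ext rfl hk.2
      rw [WeilIntegral.mono_cons, WeilIntegral.mono_cons, mono, List.map_nil, List.prod_nil, mul_one,
        hj', hk']
      exact hA81 j.1 hj.1 k.1 hk.1 hjk1
    · exact hdeg l₁ h2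
  refine Submodule.span_induction (p := fun Z _ => pairTwo Φ₁ Φ₂ Z = 0) ?_ ?_ ?_ ?_
    (cop_mono_mem_span_left l)
  · rintro Z ⟨l₁, y, hl₁, rfl⟩
    rw [pairTwo_tmul, key l₁ hl₁, zero_mul]
  · exact map_zero _
  · intro Z Z' _ _ hZ hZ'
    rw [map_add, hZ, hZ', add_zero]
  · intro a Z _ hZ
    rw [map_smul, hZ, smul_zero]

/-- **Corollary A8.2 (model form, hypotheses on `c₁` alone).**  The mirror image of
`A2TripleSumPairing.pairThree_theta_pow_mul_weil_eq_zero`. -/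
theorem pairThree_theta_pow_mul_weil_eq_zero_left [Fintype ι] (P₀ : Finset ι) (s : Bool)
    (c : ι → ℂ) (Φ₁ Φ₂ : A ι →ₗ[ℂ] ℂ)
    (hdeg : ∀ l : List (Gen ι), l.length ≠ 2 → Φ₁ (mono l) = 0)
    (hA81 : ∀ a ∈ P₀, ∀ b ∈ P₀, a ≠ b → Φ₁ (gen (a, s) * gen (b, s)) = 0) :
    pairThree Φ₁ Φ₂ (psi c P₀.card) (theta c ^ (Finset.univ \ P₀).card * weil P₀ s) = 0 := by
  obtain ⟨ε, hε, hw⟩ := WeilVector.wL_eq_smul_weil P₀ s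
  have hε0 : ε ≠ 0 := by rcases hε with rfl | rfl <;> norm_num
  have hE : ∀ p ∈ P₀, E p * wL P₀ s (Finset.univ : Finset ι).toList = 0 := fun p hp =>
    E_mul_wL P₀ s _ hp (Finset.mem_toList.mpr (Finset.mem_univ p))
  have hnd : (List.map (fun p => (p, s)) (List.filter (fun p => decide (p ∈ P₀))
      (Finset.univ : Finset ι).toList)).Nodup :=
    (List.Nodup.filter _ (Finset.nodup_toList _)).map (fun p q h => by simpa using h)
  have hP : ∀ j ∈ List.map (fun p => (p, s)) (List.filter (fun p => decide (p ∈ P₀))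
      (Finset.univ : Finset ι).toList), j.1 ∈ P₀ ∧ j.2 = s := by
    intro j hj
    obtain ⟨p, hp, rfl⟩ := List.mem_map.mp hj
    exact ⟨by simpa using (List.mem_filter.mp hp).2, rfl⟩
  have h : pairThree Φ₁ Φ₂ (psi c P₀.card)
      (theta c ^ (Finset.univ \ P₀).card * wL P₀ s (Finset.univ : Finset ι).toList) = 0 := by
    rw [theta_pow_card_mul c P₀ _ hE, map_smul, pairThree_ET_mul_wL, wL_univ_eq_mono,
      pairTwo_cop_mono_eq_zero_left P₀ s Φ₁ Φ₂ hdeg hA81 _ hnd hP, zero_mul, smul_zero]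
  rw [hw, mul_smul_comm, map_smul, smul_eq_zero] at h
  exact h.resolve_left hε0

/-- **Corollary A8.2 (integral form, hypotheses on `c₁` alone).** -/
theorem pairThree_integral_eq_zero_left [Fintype ι] (P₀ : Finset ι) (s : Bool) (c : ι → ℂ)
    (z₁ z₂ : A ι)
    (hdeg : ∀ l : List (Gen ι), l.length ≠ 2 → integral (z₁ * mono l) = 0)
    (hA81 : ∀ a ∈ P₀, ∀ b ∈ P₀, a ≠ b → integral (z₁ * (gen (a, s) * gen (b, s))) = 0) :
    pairThree (integral ∘ₗ LinearMap.mulLeft ℂ z₁) (integral ∘ₗ LinearMap.mulLeft ℂ z₂)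
      (psi c P₀.card) (theta c ^ (Finset.univ \ P₀).card * weil P₀ s) = 0 :=
  pairThree_theta_pow_mul_weil_eq_zero_left P₀ s c _ _ (fun l hl => hdeg l hl)
    (fun a ha b hb hab => hA81 a ha b hb hab)

/-- **Corollary A8.2 (degree-graded form).**  For `z₂ ∈ ⋀^{2|ι| − 2}` (the model of
`f_*c₂ ∈ H^{22}(B)`, `|ι| = 12`) with `∫_B z₂ ∧ e_{a,σ} ∧ e_{b,σ} = 0` for all `a ≠ b` in `P₀`
(Proposition A8.1 for `c₂`): `⟨m₃_*(z₁ ⊗ z₂ ⊗ θ^{|P₀|}), θ^{|univ ∖ P₀|} ∧ w_σ⟩ = 0`. -/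
theorem pairThree_integral_eq_zero_of_mem_grading [Fintype ι] (hι : 1 ≤ Fintype.card ι)
    (P₀ : Finset ι) (s : Bool) (c : ι → ℂ) (z₁ : A ι) {z₂ : A ι}
    (hz₂ : z₂ ∈ grading ι (2 * Fintype.card ι - 2))
    (hA81 : ∀ a ∈ P₀, ∀ b ∈ P₀, a ≠ b → integral (z₂ * (gen (a, s) * gen (b, s))) = 0) :
    pairThree (integral ∘ₗ LinearMap.mulLeft ℂ z₁) (integral ∘ₗ LinearMap.mulLeft ℂ z₂)
      (psi c P₀.card) (theta c ^ (Finset.univ \ P₀).card * weil P₀ s) = 0 :=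
  pairThree_integral_eq_zero P₀ s c z₁ z₂
    (fun l hl => integral_mul_mono_eq_zero_of_degree_two_complement hι hz₂ l hl) hA81

/-- **Corollary A8.2 (degree-graded form, hypotheses on `c₁` alone).** -/
theorem pairThree_integral_eq_zero_of_mem_grading_left [Fintype ι] (hι : 1 ≤ Fintype.card ι)
    (P₀ : Finset ι) (s : Bool) (c : ι → ℂ) {z₁ : A ι} (z₂ : A ι)
    (hz₁ : z₁ ∈ grading ι (2 * Fintype.card ι - 2))
    (hA81 : ∀ a ∈ P₀, ∀ b ∈ P₀, a ≠ b → integral (z₁ * (gen (a, s) * gen (b, s))) = 0) :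
    pairThree (integral ∘ₗ LinearMap.mulLeft ℂ z₁) (integral ∘ₗ LinearMap.mulLeft ℂ z₂)
      (psi c P₀.card) (theta c ^ (Finset.univ \ P₀).card * weil P₀ s) = 0 :=
  pairThree_integral_eq_zero_left P₀ s c z₁ z₂
    (fun l hl => integral_mul_mono_eq_zero_of_degree_two_complement hι hz₁ l hl) hA81

/-- **Corollary A8.2, conclusion in the coordinates of Lemma A5.6.**  If `y ∈ A ι` represents `y'`
— `∫_B y ∧ u = ⟨y', u⟩` for every `u` (the Gysin push-forward `m₃_*` is the Poincaré-dual of `m₃^*`;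
the existence of `y` is the prose step [C]) — and the coefficients `c_p` of `θ` are non-zero (A4.2.7),
then the Weil coordinate `∫_B y ∧ E_{I_σ} ∧ w_σ` of `y` vanishes: by p5's `theta_pow_card_mul`
(Lemma A5.4) `θ^{|I_σ|} ∧ w_σ = |I_σ|! (∏_{I_σ} c) E_{I_σ} ∧ w_σ`, so the vanishing of
`⟨y', θ^{|I_σ|} ∧ w_σ⟩` is the vanishing of the coordinate.  With p5's
`integral_sum_mul_ET_mul_weil` (A5.6 in coordinates) this is `p_W(y') = 0`. -/
theorem integral_mul_ET_mul_weil_eq_zero_of_represents [Fintype ι] (P₀ : Finset ι) (s : Bool)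
    (c : ι → ℂ) (hc : ∀ p, c p ≠ 0) (Φ₁ Φ₂ : A ι →ₗ[ℂ] ℂ)
    (hdeg : ∀ l : List (Gen ι), l.length ≠ 2 → Φ₂ (mono l) = 0)
    (hA81 : ∀ a ∈ P₀, ∀ b ∈ P₀, a ≠ b → Φ₂ (gen (a, s) * gen (b, s)) = 0)
    (y : A ι) (hy : ∀ u, integral (y * u) = pairThree Φ₁ Φ₂ (psi c P₀.card) u) :
    integral (y * (ET (Finset.univ \ P₀) * weil P₀ s)) = 0 := by
  have hE : ∀ p ∈ P₀, E p * weil P₀ s = 0 := fun p hp =>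
    E_mul_mono_of_mem (mem_weilList.mpr ⟨hp, rfl⟩)
  have h := pairThree_theta_pow_mul_weil_eq_zero P₀ s c Φ₁ Φ₂ hdeg hA81
  rw [← hy, theta_pow_card_mul c P₀ _ hE, mul_smul_comm, map_smul, smul_eq_zero] at h
  refine h.resolve_left ?_
  refine mul_ne_zero (Nat.cast_ne_zero.mpr (Nat.factorial_ne_zero _)) ?_
  exact Finset.prod_ne_zero_iff.mpr fun p _ => hc p

end Summit.Ventures.HodgeRepro2.A2TripleSumPairingDegree
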